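import Mathlib.RingTheory.Polynomial.Basic
import Mathlib.Data.Complex.Basic
import Literature.NumberTheory.Transcendental.ExpVarieties
import Literature.RingTheory.KrullDimension.AffineDimension
import HarnessLib

/-!
# Upper bounds for `zariskiDim` from integral coordinates

Elementary bookkeeping for the Zariski dimension `zariskiDim K W` of a subset `W ⊆ K^ι`
(`ExpVarieties.lean`: the Krull dimension of `K[X_ι] ⧸ I(W)`), complementing
`zariskiDim_le_of_coord_polys` (`ExpPointsExamples.lean`, polynomial parametrisations):

* `zariskiDim_le_of_integral_gens` — if `g : κ → K[X_ι]` and every coordinate function `X_i`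
  satisfies ON `W` a monic relation whose coefficients are polynomials in the `g k`, then
  `zariskiDim K W ≤ dim K[X_κ]`: the coordinate ring `K[X_ι] ⧸ I(W)` is integral over the image of
  `K[X_κ]` (each generator is integral, integral elements form a subring), and integral extensions
  do not raise Krull dimension (incomparability,
  `Literature.RingTheory.KrullDimension.ringKrullDim_le_of_isIntegral`, Matsumura Thm 9.3).
* `zariskiDim_le_of_integral_coords` — the special case `g k = X_{f k}` (coordinates integral over
  a sub-family of coordinates), e.g. finite unions of lines, curves with all coordinates integral
  over one linear form.
* `aeval_polyCoord`, `eval_map_map_ratPoly` — evaluation of a one-variable rational relation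
  `m(X_j)` transported to prime-field / `ℂ[X_κ]` coefficients (used to present ℚ-closed unions of
  lines `{m(x_j) = 0, …}` as `IsDefinedOver ⊥`).

Typical use (transcendence files): to feed a specific ℚ-curve `W ⊂ ℂ² × ℂ²` into a sparsity
statement one needs `zariskiDim ℂ W < 2`; exhibit `u ∈ ℂ[x, y]` proper on `W` and monic relations
for the four coordinates over `ℂ[u]` with explicit ideal-membership certificates
(`ExpPointsShapiroModel.lean`).

## References
* H. Matsumura, *Commutative Ring Theory*, CUP 1986, Thm 9.3 (incomparability).
-/

namespace Literature.NumberTheory.Transcendental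

open MvPolynomial

noncomputable section

variable {K : Type*} [Field K]

/-- **Integral coordinates bound the dimension.** If `g : κ → K[X_ι]` and every coordinate class
satisfies on `W` a monic relation whose coefficients are polynomials in the `g k`, then
`zariskiDim K W ≤ dim K[X_κ]` (`K[X_ι] ⧸ I(W)` is integral over the image of `K[X_κ]`;
incomparability). [cite: Matsumura1987, Thm 9.3] -/
theorem zariskiDim_le_of_integral_gens {ι κ : Type*} (W : Set (ι → K)) (g : κ → MvPolynomial ι K)
    (h : ∀ i, ∃ p : Polynomial (MvPolynomial κ K), p.Monic ∧
      ∀ w ∈ W, (p.map (MvPolynomial.eval fun k => MvPolynomial.eval w (g k))).eval (w i) = 0) :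
    zariskiDim K W ≤ ringKrullDim (MvPolynomial κ K) := by
  classical
  unfold zariskiDim
  set I : Ideal (MvPolynomial ι K) := MvPolynomial.vanishingIdeal K W with hI
  let ψ : MvPolynomial κ K →ₐ[K] MvPolynomial ι K := MvPolynomial.aeval g
  let φ : MvPolynomial κ K →+* MvPolynomial ι K ⧸ I := (Ideal.Quotient.mk I).comp ψ
  letI : Algebra (MvPolynomial κ K) (MvPolynomial ι K ⧸ I) := φ.toAlgebra
  have hφ : ∀ p, algebraMap (MvPolynomial κ K) (MvPolynomial ι K ⧸ I) p =
      Ideal.Quotient.mk I (ψ p) := fun p => rfl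
  have hX : ∀ i, IsIntegral (MvPolynomial κ K) (Ideal.Quotient.mk I (X i)) := by
    intro i
    obtain ⟨p, hmonic, hp⟩ := h i
    refine ⟨p, hmonic, ?_⟩
    have h1 : Polynomial.eval₂ (algebraMap (MvPolynomial κ K) (MvPolynomial ι K ⧸ I))
        (Ideal.Quotient.mk I (X i)) p =
        Ideal.Quotient.mk I (Polynomial.eval₂ ψ.toRingHom (X i) p) := by
      rw [Polynomial.hom_eval₂]
      rfl
    rw [h1, Ideal.Quotient.eq_zero_iff_mem, hI, MvPolynomial.mem_vanishingIdeal_iff]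
    intro w hw
    have h2 : (MvPolynomial.aeval w).toRingHom.comp ψ.toRingHom =
        MvPolynomial.eval fun k => MvPolynomial.eval w (g k) := by
      refine MvPolynomial.ringHom_ext (fun a => ?_) (fun k => ?_)
      · simp [ψ]
      · simp [ψ, MvPolynomial.coe_aeval_eq_eval]
    have h3 := Polynomial.hom_eval₂ p ψ.toRingHom (MvPolynomial.aeval w).toRingHom (X i)
    change (MvPolynomial.aeval w).toRingHom _ = 0
    rw [h3, h2]
    have h4 : (MvPolynomial.aeval w).toRingHom (X i : MvPolynomial ι K) = w i := by simp
    rw [h4, ← Polynomial.eval_map]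
    exact hp w hw
  haveI : Algebra.IsIntegral (MvPolynomial κ K) (MvPolynomial ι K ⧸ I) := by
    refine ⟨fun q => ?_⟩
    obtain ⟨q, rfl⟩ := Ideal.Quotient.mk_surjective q
    induction q using MvPolynomial.induction_on with
    | C a =>
      have : Ideal.Quotient.mk I (C a) =
          algebraMap (MvPolynomial κ K) (MvPolynomial ι K ⧸ I) (C a) := by
        rw [hφ]
        simp [ψ]
      rw [this]
      exact isIntegral_algebraMap
    | add p q hp hq => rw [map_add]; exact hp.add hq
    | mul_X p i hp => rw [map_mul]; exact hp.mul (hX i)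
  exact Literature.RingTheory.KrullDimension.ringKrullDim_le_of_isIntegral

/-- **Coordinates integral over a sub-family of coordinates bound the dimension**: the case
`g k = X_{f k}` of `zariskiDim_le_of_integral_gens`. [cite: Matsumura1987, Thm 9.3] -/
theorem zariskiDim_le_of_integral_coords {ι κ : Type*} (W : Set (ι → K)) (f : κ → ι)
    (h : ∀ i, ∃ p : Polynomial (MvPolynomial κ K), p.Monic ∧
      ∀ w ∈ W, (p.map (MvPolynomial.eval fun k => w (f k))).eval (w i) = 0) :
    zariskiDim K W ≤ ringKrullDim (MvPolynomial κ K) := by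
  refine zariskiDim_le_of_integral_gens W (fun k => X (f k)) fun i => ?_
  obtain ⟨p, hp, hpW⟩ := h i
  refine ⟨p, hp, fun w hw => ?_⟩
  simpa only [MvPolynomial.eval_X] using hpW w hw

/-- Evaluating the transported one-variable relation `m(X_j)` (coefficients moved into the prime
field `⊥ ≤ ℂ`) at a point `w` gives `m(w j)`. [folklore] -/
theorem aeval_polyCoord {ι : Type*} (w : ι → ℂ) (j : ι) (m : Polynomial ℚ) :
    MvPolynomial.aeval w (Polynomial.aeval (X j : MvPolynomial ι (⊥ : Subfield ℂ))
      (m.map (algebraMap ℚ (⊥ : Subfield ℂ)))) = Polynomial.aeval (w j) m := by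
  rw [← Polynomial.aeval_algHom_apply, MvPolynomial.aeval_X, Polynomial.aeval_def,
    Polynomial.eval₂_map, Polynomial.aeval_def,
    RingHom.ext_rat ((algebraMap (⊥ : Subfield ℂ) ℂ).comp (algebraMap ℚ (⊥ : Subfield ℂ)))
      (algebraMap ℚ ℂ)]

/-- A one-variable rational relation transported to `ℂ[X_κ]`-coefficients evaluates as expected.
[folklore] -/
theorem eval_map_map_ratPoly {κ : Type*} (v : κ → ℂ) (z : ℂ) (m : Polynomial ℚ) :
    ((m.map (algebraMap ℚ (MvPolynomial κ ℂ))).map (MvPolynomial.eval v)).eval z =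
      Polynomial.aeval z m := by
  rw [Polynomial.map_map, Polynomial.eval_map, Polynomial.aeval_def]
  try (congr 1; exact RingHom.ext_rat _ _)

end

end Literature.NumberTheory.Transcendental
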